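import Summits.ValiantsHypothesis.ValiantsHypothesis.Theorems.SymPencilPerFourPairingDiscSixProductTools

/-!
# Route `SymPencil` — the pairing discriminant on a six-dimensional two-row space, PRODUCT CASE:
# if neither row is onto then `V' = {α_m = 0} × {β_m = 0}`
# (towards leaf 5 `stub_twoLineFilter`; `--supports` stmt-ValiantsHypothesis-5674
# `SdcSuperquadratic`; rung currency only, nothing here bears on `VP ≠ VNP`)

Coordinates on `K⁸ = K^{Fin 4 ⊕ Fin 4}`: `α_i = Y (inl i)`, `β_i = Y (inr i)`; `A·B = 4Π` is the
vanishing of the pairing discriminant (`SymPencilPerFourPairingDiscTools`).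

**Theorem** (`coord_pair_vanish_of_not_onto`, CASE III).  Let `V' ≤ K⁸` be `6`-dimensional with
`A·B = 4Π` on `V'`, and suppose neither `α` nor `β` maps `V'` onto `K⁴`.  Then for one index `m`
both `α_m` and `β_m` vanish on `V'` (so `V' = {α_m = 0} × {β_m = 0}`, the `W_col`-type).
Proof: by dimension `V' ⊇ A × 0` and `0 × B` for the two hyperplanes `A = α(V')`, `B = β(V')`,
hence `V' = A × B`; for `j ≠ l`, on `{α_l = β_j = 0}` the discriminant is a product of coordinates
(`SymPencilPerFourPairingHyperplane`), so (`pair_dichotomy`) either `A ∩ {a_l = 0} ⊆ {a_i = 0}`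
for some `i ≠ l` ("`P l`") or `B ∩ {b_j = 0} ⊆ {b_i = 0}` for some `i ≠ j` ("`Q j`"); a hyperplane
with `P l` (witness `i`) contains the unit vectors `e_k`, `k ∉ {i, l}`, and not `e_i`
(`SymPencilPerFourPairingDiscSixProductTools.single_mem_of_P`); the resulting finite
combinatorics on `Fin 4` (`combQ`, `combP`, by `decide`) forces `e_k ∈ A` and `e_k ∈ B` for all `k ≠ m`, i.e. `A = {a_m = 0}`, `B = {b_m = 0}`
(`coord_vanish_of_singles`).

Honest framing: lemmas; `27 ≤ sdc(per₄) ≤ 29` unchanged, stmt-5674 open, `VP ≠ VNP` not moved, no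
summit statement is proved here.  No definitions, no named facts. [folklore]
-/

noncomputable section

-- single-conjunct layout: Sub = Summit, duplicated namespace component intended
set_option linter.dupNamespace false

namespace Summit.ValiantsHypothesis.ValiantsHypothesis.Theorems.SymPencilPerFourPairingDiscSixProduct

open Matrix Finset Module Polynomial
open Literature.Computability.AlgebraicComplexity.AlperBogartVelasco
open Summit.ValiantsHypothesis.ValiantsHypothesis.Theorems.SymPencilPerFourPairingHyperplane
open Summit.ValiantsHypothesis.ValiantsHypothesis.Theorems.SymPencilPerFourPairingDiscTools
open Summit.ValiantsHypothesis.ValiantsHypothesis.Theorems.SymPencilPerFourPairingDiscSixProductTools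

variable {K : Type*} [Field K]

/-! ### The pair dichotomy from the discriminant on `A × B` -/

/-- **The pair dichotomy.**  If `A·B = 4Π` at `(a; b)` for all `a ∈ A`, `b ∈ B`, then for
`j ≠ l`: `P l` (some `a_i`, `i ≠ l`, vanishes on `A ∩ {a_l = 0}`) or `Q j` (some `b_i`, `i ≠ j`,
vanishes on `B ∩ {b_j = 0}`) — because on `{α_l = β_j = 0}` the discriminant is the product of the
coordinates `a_j, (b_i)_{i≠j}, b_l, (a_i)_{i≠l}`, none of which vanishes identically otherwise
(`exists_mem_forall_ne_zero`). [folklore] -/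
theorem pair_dichotomy [CharZero K] (A B : Submodule K (Fin 4 → K))
    (hdisc : ∀ a ∈ A, ∀ b ∈ B,
      (∑ j, ∏ i, if i = j then a i else b i) * (∑ j, ∏ i, if i = j then b i else a i) =
        4 * ∏ i, a i * b i)
    (j l : Fin 4) (hjl : j ≠ l) :
    (∃ i, i ≠ l ∧ ∀ a ∈ A, a l = 0 → a i = 0) ∨ (∃ i, i ≠ j ∧ ∀ b ∈ B, b j = 0 → b i = 0) := by
  classical
  by_contra hne
  push Not at hne
  obtain ⟨hnP, hnQ⟩ := hne
  -- `a₀ ∈ A` with `a₀ l = 0` and all other coordinates non-zero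
  obtain ⟨a₀, ha₀, ha₀ne⟩ := exists_mem_forall_ne_zero (A ⊓ LinearMap.ker (LinearMap.proj l))
    (fun i => (LinearMap.proj i : (Fin 4 → K) →ₗ[K] K)) (Finset.univ.erase l) (by
      intro i hi
      obtain ⟨a, ha, hal, hai⟩ := hnP i (Finset.ne_of_mem_erase hi)
      exact ⟨a, Submodule.mem_inf.2 ⟨ha, by simpa [LinearMap.mem_ker] using hal⟩, by simpa using hai⟩)
  obtain ⟨b₀, hb₀, hb₀ne⟩ := exists_mem_forall_ne_zero (B ⊓ LinearMap.ker (LinearMap.proj j))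
    (fun i => (LinearMap.proj i : (Fin 4 → K) →ₗ[K] K)) (Finset.univ.erase j) (by
      intro i hi
      obtain ⟨b, hb, hbj, hbi⟩ := hnQ i (Finset.ne_of_mem_erase hi)
      exact ⟨b, Submodule.mem_inf.2 ⟨hb, by simpa [LinearMap.mem_ker] using hbj⟩, by simpa using hbi⟩)
  rw [Submodule.mem_inf, LinearMap.mem_ker] at ha₀ hb₀
  have hal : a₀ l = 0 := by simpa using ha₀.2
  have hbj : b₀ j = 0 := by simpa using hb₀.2
  have ha' : ∀ i, i ≠ l → a₀ i ≠ 0 := fun i hi => by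
    simpa using ha₀ne i (Finset.mem_erase.2 ⟨hi, Finset.mem_univ i⟩)
  have hb' : ∀ i, i ≠ j → b₀ i ≠ 0 := fun i hi => by
    simpa using hb₀ne i (Finset.mem_erase.2 ⟨hi, Finset.mem_univ i⟩)
  -- the discriminant at `(a₀; b₀)` is a product of non-zero coordinates
  have h := hdisc a₀ ha₀.1 b₀ hb₀.1
  have hA : (∑ j', ∏ i, if i = j' then a₀ i else b₀ i) =
      ∏ i, (if i = j then a₀ i else b₀ i) := by
    rw [Finset.sum_eq_single j]
    · intro j' _ hj'
      exact Finset.prod_eq_zero (Finset.mem_univ j) (by rw [if_neg (Ne.symm hj'), hbj])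
    · intro h; exact absurd (Finset.mem_univ j) h
  have hB : (∑ j', ∏ i, if i = j' then b₀ i else a₀ i) =
      ∏ i, (if i = l then b₀ i else a₀ i) := by
    rw [Finset.sum_eq_single l]
    · intro j' _ hj'
      exact Finset.prod_eq_zero (Finset.mem_univ l) (by rw [if_neg (Ne.symm hj'), hal])
    · intro h; exact absurd (Finset.mem_univ l) h
  have hPi : ∏ i, a₀ i * b₀ i = 0 :=
    Finset.prod_eq_zero (Finset.mem_univ l) (by rw [hal, zero_mul])
  rw [hA, hB, hPi, mul_zero] at h
  rcases mul_eq_zero.1 h with h1 | h2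
  · obtain ⟨i, -, hi⟩ := Finset.prod_eq_zero_iff.1 h1
    by_cases hij : i = j
    · rw [if_pos hij] at hi; exact ha' i (hij ▸ hjl) hi
    · rw [if_neg hij] at hi; exact hb' i hij hi
  · obtain ⟨i, -, hi⟩ := Finset.prod_eq_zero_iff.1 h2
    by_cases hil : i = l
    · rw [if_pos hil] at hi; exact hb' i (hil ▸ hjl.symm) hi
    · rw [if_neg hil] at hi; exact ha' i hil hi

/-! ### Case III -/

/-- **CASE III.**  See the module docstring. [folklore] -/
theorem coord_pair_vanish_of_not_onto [CharZero K] (V' : Submodule K (Fin 4 ⊕ Fin 4 → K))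
    (h6 : finrank K V' = 6)
    (hdisc : ∀ Y ∈ V',
      (∑ j, ∏ i, if i = j then Y (Sum.inl i) else Y (Sum.inr i)) *
        (∑ j, ∏ i, if i = j then Y (Sum.inr i) else Y (Sum.inl i)) =
        4 * ∏ i, Y (Sum.inl i) * Y (Sum.inr i))
    (hα : V'.map (LinearMap.funLeft K K Sum.inl : (Fin 4 ⊕ Fin 4 → K) →ₗ[K] (Fin 4 → K)) ≠ ⊤)
    (hβ : V'.map (LinearMap.funLeft K K Sum.inr : (Fin 4 ⊕ Fin 4 → K) →ₗ[K] (Fin 4 → K)) ≠ ⊤) :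
    ∃ m : Fin 4, ∀ Y ∈ V', Y (Sum.inl m) = 0 ∧ Y (Sum.inr m) = 0 := by
  classical
  set πα : (Fin 4 ⊕ Fin 4 → K) →ₗ[K] (Fin 4 → K) := LinearMap.funLeft K K Sum.inl with hπαdef
  set πβ : (Fin 4 ⊕ Fin 4 → K) →ₗ[K] (Fin 4 → K) := LinearMap.funLeft K K Sum.inr with hπβdef
  have hπα : ∀ Y i, πα Y i = Y (Sum.inl i) := fun _ _ => rfl
  have hπβ : ∀ Y i, πβ Y i = Y (Sum.inr i) := fun _ _ => rfl
  set A := V'.map πα with hA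
  set B := V'.map πβ with hB
  -- dimensions: `dim A, dim B ≤ 3`, kernels `≥ 3`
  have h4 : finrank K (Fin 4 → K) = 4 := by
    rw [Module.finrank_fintype_fun_eq_card, Fintype.card_fin]
  have hA3 : finrank K A ≤ 3 := by
    have := Submodule.finrank_lt hα
    rw [h4] at this; omega
  have hB3 : finrank K B ≤ 3 := by
    have := Submodule.finrank_lt hβ
    rw [h4] at this; omega
  set Kβ : Submodule K (Fin 4 ⊕ Fin 4 → K) := V' ⊓ LinearMap.ker πα with hKβ
  set Kα : Submodule K (Fin 4 ⊕ Fin 4 → K) := V' ⊓ LinearMap.ker πβ with hKα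
  have memKβ : ∀ k, k ∈ Kβ ↔ k ∈ V' ∧ ∀ i, k (Sum.inl i) = 0 := fun k => by
    rw [hKβ, Submodule.mem_inf, LinearMap.mem_ker]
    exact ⟨fun h => ⟨h.1, fun i => by simpa [hπα] using congr_fun h.2 i⟩,
      fun h => ⟨h.1, funext fun i => h.2 i⟩⟩
  have memKα : ∀ k, k ∈ Kα ↔ k ∈ V' ∧ ∀ i, k (Sum.inr i) = 0 := fun k => by
    rw [hKα, Submodule.mem_inf, LinearMap.mem_ker]
    exact ⟨fun h => ⟨h.1, fun i => by simpa [hπβ] using congr_fun h.2 i⟩,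
      fun h => ⟨h.1, funext fun i => h.2 i⟩⟩
  have hKβ3 : 3 ≤ finrank K Kβ := by
    have h := finrank_eq_finrank_map_add_finrank_inf_ker V' πα
    rw [h6, ← hA, ← hKβ] at h; omega
  have hKα3 : 3 ≤ finrank K Kα := by
    have h := finrank_eq_finrank_map_add_finrank_inf_ker V' πβ
    rw [h6, ← hB, ← hKα] at h; omega
  have hbotβ : (Kβ ⊓ LinearMap.ker πβ : Submodule K _) = ⊥ := by
    refine (Submodule.eq_bot_iff _).2 fun k hk => ?_
    rw [Submodule.mem_inf, memKβ, LinearMap.mem_ker] at hk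
    funext c
    rcases c with i | i
    · exact hk.1.2 i
    · simpa [hπβ] using congr_fun hk.2 i
  have hbotα : (Kα ⊓ LinearMap.ker πα : Submodule K _) = ⊥ := by
    refine (Submodule.eq_bot_iff _).2 fun k hk => ?_
    rw [Submodule.mem_inf, memKα, LinearMap.mem_ker] at hk
    funext c
    rcases c with i | i
    · simpa [hπα] using congr_fun hk.2 i
    · exact hk.1.2 i
  have hKβeq : finrank K Kβ = finrank K (Kβ.map πβ) := by
    have h := finrank_eq_finrank_map_add_finrank_inf_ker Kβ πβ
    rw [hbotβ, finrank_bot, add_zero] at h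
    exact h
  have hKαeq : finrank K Kα = finrank K (Kα.map πα) := by
    have h := finrank_eq_finrank_map_add_finrank_inf_ker Kα πα
    rw [hbotα, finrank_bot, add_zero] at h
    exact h
  -- `Kβ.map πβ = B` and `Kα.map πα = A`
  have hleB : Kβ.map πβ ≤ B := Submodule.map_mono inf_le_left
  have hleA : Kα.map πα ≤ A := Submodule.map_mono inf_le_left
  have hKβB : Kβ.map πβ = B :=
    Submodule.eq_of_le_of_finrank_le hleB (by rw [← hKβeq]; exact hB3.trans hKβ3)
  have hKαA : Kα.map πα = A :=
    Submodule.eq_of_le_of_finrank_le hleA (by rw [← hKαeq]; exact hA3.trans hKα3)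
  have hAdim : finrank K A = 3 := by
    have h1 := Submodule.finrank_mono hleA
    rw [← hKαeq] at h1
    omega
  have hBdim : finrank K B = 3 := by
    have h1 := Submodule.finrank_mono hleB
    rw [← hKβeq] at h1
    omega
  -- `(a; b) ∈ V'` for `a ∈ A`, `b ∈ B`
  have hmem : ∀ a ∈ A, ∀ b ∈ B, (fun c => Sum.elim a b c : Fin 4 ⊕ Fin 4 → K) ∈ V' := by
    intro a ha b hb
    rw [← hKαA, Submodule.mem_map] at ha
    rw [← hKβB, Submodule.mem_map] at hb
    obtain ⟨ka, hka, rfl⟩ := ha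
    obtain ⟨kb, hkb, rfl⟩ := hb
    obtain ⟨hkaV, hka0⟩ := (memKα ka).1 hka
    obtain ⟨hkbV, hkb0⟩ := (memKβ kb).1 hkb
    have : (fun c => Sum.elim (πα ka) (πβ kb) c : Fin 4 ⊕ Fin 4 → K) = ka + kb := by
      funext c
      rcases c with i | i
      · simp [hπα, hkb0 i]
      · simp [hπβ, hka0 i]
    rw [this]
    exact V'.add_mem hkaV hkbV
  have hdiscAB : ∀ a ∈ A, ∀ b ∈ B,
      (∑ j, ∏ i, if i = j then a i else b i) * (∑ j, ∏ i, if i = j then b i else a i) =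
        4 * ∏ i, a i * b i := by
    intro a ha b hb
    simpa using hdisc _ (hmem a ha b hb)
  -- the pair dichotomy and the combinatorics
  have PQ := pair_dichotomy A B hdiscAB
  obtain ⟨m, hAm, hBm⟩ : ∃ m : Fin 4, (∀ a ∈ A, a m = 0) ∧ (∀ b ∈ B, b m = 0) := by
    by_cases hP : ∀ l, ∃ i, i ≠ l ∧ ∀ a ∈ A, a l = 0 → a i = 0
    · exact absurd hP (fun h => false_of_P_all A hα hAdim h)
    · push Not at hP
      obtain ⟨l, hl⟩ := hP
      have hQ : ∀ j, j ≠ l → ∃ i, i ≠ j ∧ ∀ b ∈ B, b j = 0 → b i = 0 := by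
        intro j hjl
        rcases PQ j l hjl with ⟨i, hil, hi⟩ | hq
        · exact absurd hi (by
            intro h
            obtain ⟨a, ha, hal, hai⟩ := hl i hil
            exact hai (h a ha hal))
        · exact hq
      have hBl := coord_vanish_of_Q B hβ hBdim l hQ
      -- now `Q l` fails, so `P l'` for all `l' ≠ l`
      have hP' : ∀ l', l' ≠ l → ∃ i, i ≠ l' ∧ ∀ a ∈ A, a l' = 0 → a i = 0 := by
        intro l' hl'
        rcases PQ l l' hl'.symm with hp | ⟨i, hil, hi⟩
        · exact hp
        · exfalso
          -- `e_i ∈ B` (as `i ≠ l` and `B = {b_l = 0}` contains it), contradiction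
          have hei : (Pi.single i 1 : Fin 4 → K) ∈ B :=
            single_mem_of_coord_vanish B hBdim hBl i hil
          have := hi _ hei (by simp [hil])
          simp at this
      have hAl := coord_vanish_of_Q A hα hAdim l hP'
      exact ⟨l, hAl, hBl⟩
  refine ⟨m, fun Y hY => ⟨?_, ?_⟩⟩
  · have : πα Y ∈ A := Submodule.mem_map_of_mem hY
    simpa [hπα] using hAm _ this
  · have : πβ Y ∈ B := Submodule.mem_map_of_mem hY
    simpa [hπβ] using hBm _ this

end Summit.ValiantsHypothesis.ValiantsHypothesis.Theorems.SymPencilPerFourPairingDiscSixProduct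

end
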